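import Summits.QuantumFields.BalabanUV.Beta.GAN24.BornLambdaLineage
import Summits.QuantumFields.BalabanUV.Beta.GAN24.RespStepEffectiveEL
import Summits.QuantumFields.BalabanUV.Beta.GAN24.TaylorLamBracket

/-!
# `BalabanUV.Beta.GAN24.BornLambdaTent` — binder row G-an2-4 / (CONV-C), CT-ROUTE, `gen20/BORNSEC-PLAN-v1.md` §0 (c1) ∕ (Λ-U)(u3): **THE Λ-SOURCE OF EVERY MEMBER
# OF THE COMB FAMILY (E), IN THE ADOPTED UNITS, IS THE Λ-PIECE WHOSE COEFFICIENT IS THE `Lc`-CONTOUR TENT OF THE NEXT LEVEL'S UNIT MULTIPLIER KERNEL** —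
# one formula for member `0` (road S3's `lamCoeffOf (KInv Lc)`) and for the members `j+1` (the step coefficients `lamCoeffK (KStepUnit Lc (j+1)) (…E2…)`)

NOT IN PRINT; OUR BOOKKEEPING (row owner `b2b-balaban-gan24-p1`, gen 20; [folklore] over tree theorems BY NAME: leaf-01 g59's `BornLambdaLineage.unitS_freshAt_lam_zero ∕
_succ` (p286890), the owner's `RespStepEffectiveEL.lamCoeffK_KInvStep_E2_eq_neg_contourSumAdj` (X-gan24p1-g20-1) and `StencilSlotLam.lamCoeffK_unit`, road S3's
`TaylorLamBracket.lamCoeffOf_KInv_eq_neg_contourSumAdj_shift` (member `0`), an2's `InterLevelTransport.SLam` ∕ `cwsum_apply`).  0 `def`, 0 cited facts,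
0 `def … : Prop`, 0 sorry; NO estimate.  HONEST FRAMING (cell contract, verbatim): «discharging `BetaPertH` makes Bałaban's UV stability UNCONDITIONAL — a real
constructive-QFT result; it is NOT the continuum limit and NOT the Clay problem.»  HONEST DEPENDENCY (verbatim): «continuum YM on T⁴ ⇐ BetaPertH ∧ nine spine
estimates (0/9 proved); BetaPertH ⇐ (D1) ∧ (D4) ∧ CAP+tail; G-an2-4 gates asym, D1 and NE2/3/4.»  Discharges NO slot letter; NEVER «G-an2-4 closed»; NOT D1, NOT
`BetaPertH`, NOT continuum, NOT Clay.

## What (generic `d`; `Lc` with `[NeZero Lc]`; any root `ρ`, any `cΛ`)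
* §1 `SLam_const_mul` (a scalar in the coefficients is a scalar on the Λ-piece); `contourSumAdj_const_mul`.
* §2 **`lamCoeffK_KStepUnit_eq_neg_tent`**: `lamCoeffK (KStepUnit Lc (j+1)) ((smStep d Lc j)² • E2 d Lc (j+1)) Lc μ y κ u
  = −(Lc^{2(d+1)})⁻¹ · contourSumAdj Lc (fun κ′ y′ ↦ (Lc^{j+1})^{2(d+1)}·wΦ_{Lc^{j+2}} κ′ μ (y′ − y)) κ u` — the UNIT step Lagrange coefficient of leaf-01's
  `unitS_freshAt_lam_succ` is `−Lc^{−2(d+1)}` times the `Lc`-contour tent of the NEXT level's UNIT multiplier kernel `Ê_{j+2} := (Lc^{j+1})^{2(d+1)}·wΦ_{Lc^{j+2}}`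
  (= `(smStep d Lc (j+1))² • E2 d Lc (j+2)` at coarse points — the mm block of road P1's unit kernel `KStepUnit Lc (j+1)`).
* §3 **`unitS_freshAt_lam_zero_eq_tent`** ∕ **`unitS_freshAt_lam_succ_eq_tent`**: for EVERY member,
  `unitS_j (freshAt Lc ρ 0 cΛ j) = fun κ u ↦ (−cΛ) • SLam Lc (fun μ y κ′ u′ ↦ contourSumAdj Lc (fun κ″ y″ ↦ Ê_{j+1} κ″ μ (y″ − y)) κ′ u′) H_ρ κ u` with
  `Ê_1 = wΦ_{Lc}` (member `0`, road S3's one-shot identity) and `Ê_{j+2} = (Lc^{j+1})^{2(d+1)}·wΦ_{Lc^{j+2}}` (members `j+1`, §2): ONE SHAPE along the tower,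
  weight `−cΛ` (j-FREE), kernel = the next level's unit multiplier kernel read through the one-step contour tent.  Consequences (BORNSEC-PLAN v1): (i) the uniform letter `hX` is the K-slot's uniform decay of the unit mm kernels,
  one line (leaf-01's `exists_hX_lam_three` reaches it through `abs_lamCoeffK_le`; this is the structural reason); (ii) the vertex slot of every Λ-lineage pairs a
  response leg with a `𝒬ᵀ`-tent, so `𝒬 ∘ (leg)` appears — the next-level leg (`RespStepConstraint` ∕ `contourSum_mul`), dressed or undressed alike.
Unit `b2b-balaban-gan24-p1` (row owner G-an2-4, gen 20), 2026-08-21.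
-/

noncomputable section

open Finset
open scoped BigOperators
open Literature.MathematicalPhysics.QuantumFieldTheory
open Literature.MathematicalPhysics.QuantumFieldTheory.Balaban1983to89
open Literature.MathematicalPhysics.QuantumFieldTheory.Balaban1983to89.Beta
open ExpKernelCalculus (MKer)
open AffineAveraging (Form1)
open AffineReproduction (contourSumAdj)
open KernelSpecInstance (wΦ)
open OneStepResolventKernel (Fib KInv)
open OneStepKernelFamily (KInvStep)
open BalabanStepJets (lamCoeffOf)
open BalabanStepJetsSucc (E2 lamCoeffK mmRead_inr_left)
open AveragingHessianKernelsRooted (hessFFAt)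
open InterLevelTransport (SLam cwsum cwsum_apply)
open Summit.QuantumFields.BalabanUV.Beta.HessKerDressedUnits (unitS unitK)
open Summit.QuantumFields.BalabanUV.Beta.GAN24.CombesThomas (sfStep smStep KStepUnit sfStep_ne_zero smStep_ne_zero)
open Summit.QuantumFields.BalabanUV.Beta.GAN24.SrecBornSector (freshAt)
open Summit.QuantumFields.BalabanUV.Beta.GAN24.BornLambdaLineage (unitS_freshAt_lam_zero unitS_freshAt_lam_succ)
open Summit.QuantumFields.BalabanUV.Beta.GAN24.RespStepEffectiveEL (lamCoeffK_KInvStep_E2_eq_neg_contourSumAdj)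
open Summit.QuantumFields.BalabanUV.Beta.GAN24.TaylorLamBracket (lamCoeffOf_KInv_eq_neg_contourSumAdj_shift)

namespace Summit.QuantumFields.BalabanUV.Beta.GAN24.BornLambdaTent

variable {d : ℕ}

/-! ## §1 Scalars through the Λ-piece and the contour-sum adjoint -/

/-- [folklore] A constant factor in the conversion coefficients is a constant factor on the Λ-piece. -/
theorem SLam_const_mul (N : ℕ) [NeZero N] (a : ℝ) (c : Fin (d + 1) → (Fin (d + 1) → ℤ) → Fin (d + 1) → (Fin (d + 1) → ℤ) → ℝ)
    (Q2 : Fin (d + 1) → (Fin (d + 1) → ℤ) → MKer (d + 1) (Fib d)) (κ : Fin (d + 1)) (u : Fin (d + 1) → ℤ) :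
    SLam N (fun μ y κ' u' => a * c μ y κ' u') Q2 κ u = a • SLam N c Q2 κ u := by
  funext x z p b
  simp only [SLam, Pi.smul_apply, smul_eq_mul, cwsum_apply, mul_assoc, tsum_mul_left, Finset.mul_sum, mul_neg]

/-- [folklore] A constant factor passes through the contour-sum adjoint. -/
theorem contourSumAdj_const_mul (N : ℕ) (a : ℝ) (φ : Form1 (d + 1) ℝ) (κ : Fin (d + 1)) (x : Fin (d + 1) → ℤ) :
    contourSumAdj N (fun κ' y' => a * φ κ' y') κ x = a * contourSumAdj N φ κ x := by
  simp only [contourSumAdj, Finset.mul_sum]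

/-! ## §2 The unit step Lagrange coefficient is a tent of the next level's unit multiplier kernel -/

section Step

variable {Lc : ℕ} [NeZero Lc]

/-- NOT IN PRINT; OUR BOOKKEEPING ([folklore]).  **THE UNIT STEP LAGRANGE COEFFICIENT IS `−Lc^{−2(d+1)}` TIMES THE `Lc`-CONTOUR TENT OF THE NEXT LEVEL'S
UNIT MULTIPLIER KERNEL**: for every `j`,
`lamCoeffK (KStepUnit Lc (j+1)) ((smStep d Lc j)² • E2 d Lc (j+1)) Lc μ y κ u = −(Lc^{2(d+1)})⁻¹ · contourSumAdj Lc (fun κ′ y′ ↦ (Lc^{j+1})^{2(d+1)}·wΦ_{Lc^{j+2}} κ′ μ (y′ − y)) κ u`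
(`StencilSlotLam.lamCoeffK_unit` to the raw coefficient, the owner's `RespStepEffectiveEL.lamCoeffK_KInvStep_E2_eq_neg_contourSumAdj`, and the arithmetic
`s_m·s_f·t·((Lc^{j+1})^{d+2})⁻¹ = Lc^{2j(d+1)}`). -/
theorem lamCoeffK_KStepUnit_eq_neg_tent (j : ℕ) (μ : Fin (d + 1)) (y : Fin (d + 1) → ℤ) (κ : Fin (d + 1)) (u : Fin (d + 1) → ℤ) :
    lamCoeffK (KStepUnit (d := d) Lc (j + 1)) ((smStep d Lc j) ^ 2 • E2 d Lc (j + 1)) Lc μ y κ u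
      = -(((Lc : ℝ) ^ (2 * (d + 1)))⁻¹ *
          contourSumAdj Lc (fun κ' y' => ((Lc : ℝ) ^ (j + 1)) ^ (2 * (d + 1)) * wΦ (N := Lc ^ (j + 2)) (d := d) κ' μ (y' - y)) κ u) := by
  have hL : (Lc : ℝ) ≠ 0 := Nat.cast_ne_zero.2 (NeZero.ne Lc)
  have hsf : sfStep Lc (j + 1) ≠ 0 := sfStep_ne_zero (j + 1)
  have hsm : smStep d Lc (j + 1) ≠ 0 := smStep_ne_zero (d := d) (j + 1)
  have ht : (smStep d Lc j) ^ 2 ≠ 0 := pow_ne_zero _ (smStep_ne_zero (d := d) j)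
  have hE : ∀ y z (ν : Fin (d + 1)) (b : Fib d), E2 d Lc (j + 1) y z (Sum.inr ν) b = 0 := fun y z ν b => by
    unfold E2; exact mmRead_inr_left _ _ _ _ _ _
  -- raw = scalar · unit (`lamCoeffK_unit`), raw = tent (`lamCoeffK_KInvStep_E2_eq_neg_contourSumAdj`)
  have hu := StencilSlotLam.lamCoeffK_unit hsf hsm ht (KInvStep (d := d) Lc (j + 1)) (E2 d Lc (j + 1)) hE Lc μ y κ u
  have hraw := lamCoeffK_KInvStep_E2_eq_neg_contourSumAdj (d := d) (Lc := Lc) (j + 1) μ y κ u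
  rw [show unitK (sfStep Lc (j + 1)) (smStep d Lc (j + 1)) (KInvStep (d := d) Lc (j + 1)) = KStepUnit (d := d) Lc (j + 1) from rfl] at hu
  rw [hu] at hraw
  -- solve for the unit coefficient
  have hc : (smStep d Lc (j + 1) * sfStep Lc (j + 1))⁻¹ * ((smStep d Lc j) ^ 2)⁻¹ ≠ 0 :=
    mul_ne_zero (inv_ne_zero (mul_ne_zero hsm hsf)) (inv_ne_zero ht)
  have key := (eq_inv_mul_iff_mul_eq₀ hc).mpr hraw
  rw [key, contourSumAdj_const_mul]
  simp only [smStep, sfStep, Nat.cast_pow, mul_inv, inv_inv]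
  field_simp
  ring

end Step

/-! ## §3 The Λ-source of every member in units: one tent shape along the tower -/

section Tower

variable {Lc : ℕ} [NeZero Lc]

/-- NOT IN PRINT; OUR BOOKKEEPING ([folklore]).  **MEMBER `0`**: `unitS_0 (freshAt Lc ρ 0 cΛ 0) = fun κ u ↦ (−cΛ) • SLam Lc (fun μ y κ′ u′ ↦ 𝒬ᵀ_{Lc}[wΦ_{Lc}(·; μ, · − y)](κ′, u′)) H_ρ κ u`
— leaf-01's `unitS_freshAt_lam_zero` and road S3's `lamCoeffOf_KInv_eq_neg_contourSumAdj_shift` (the tent of the level-`1` multiplier kernel; `(Lc^0)^{2(d+1)} = 1`). -/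
theorem unitS_freshAt_lam_zero_eq_tent (ρ : Fin (d + 1) → ℤ) (cΛ : ℝ) :
    unitS (sfStep Lc 0) (smStep d Lc 0) (freshAt Lc ρ 0 cΛ 0)
      = fun κ u => (-cΛ) • SLam Lc (fun μ y κ' u' =>
          contourSumAdj Lc (fun κ'' q => wΦ (N := Lc) (d := d) κ'' μ (q - y)) κ' u') (fun μ y => hessFFAt ρ Lc μ y) κ u := by
  rw [unitS_freshAt_lam_zero]
  funext κ u
  have e0 : lamCoeffOf (KInv (N := Lc) (d := d)) Lc = fun μ y κ' u' => (-1 : ℝ) *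
      contourSumAdj Lc (fun κ'' q => wΦ (N := Lc) (d := d) κ'' μ (q - y)) κ' u' := by
    funext μ y κ' u'
    rw [lamCoeffOf_KInv_eq_neg_contourSumAdj_shift (N := Lc) μ y κ' u', neg_one_mul]
  rw [e0, SLam_const_mul, smul_smul, mul_neg_one]

/-- NOT IN PRINT; OUR BOOKKEEPING ([folklore]).  **MEMBERS `j+1`**: `unitS_{j+1} (freshAt Lc ρ 0 cΛ (j+1)) = fun κ u ↦ (−cΛ) • SLam Lc (fun μ y κ′ u′ ↦
𝒬ᵀ_{Lc}[(Lc^{j+1})^{2(d+1)}·wΦ_{Lc^{j+2}}(·; μ, · − y)](κ′, u′)) H_ρ κ u` — leaf-01's `unitS_freshAt_lam_succ` (weight `cΛ·Lc^{2(d+1)}`) and §2 (coefficient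
`−Lc^{−2(d+1)}·𝒬ᵀ[Ê_{j+2}]`): the two `Lc^{2(d+1)}` cancel — THE SAME SHAPE AS MEMBER `0` with the next level's UNIT multiplier kernel `Ê_{j+2} := (Lc^{j+1})^{2(d+1)}·wΦ_{Lc^{j+2}}`
in place of `wΦ_{Lc} = Ê_1`, weight `−cΛ` j-FREE. -/
theorem unitS_freshAt_lam_succ_eq_tent (ρ : Fin (d + 1) → ℤ) (cΛ : ℝ) (j : ℕ) :
    unitS (sfStep Lc (j + 1)) (smStep d Lc (j + 1)) (freshAt Lc ρ 0 cΛ (j + 1))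
      = fun κ u => (-cΛ) • SLam Lc (fun μ y κ' u' =>
          contourSumAdj Lc (fun κ'' y'' => ((Lc : ℝ) ^ (j + 1)) ^ (2 * (d + 1)) * wΦ (N := Lc ^ (j + 2)) (d := d) κ'' μ (y'' - y)) κ' u')
          (fun μ y => hessFFAt ρ Lc μ y) κ u := by
  rw [unitS_freshAt_lam_succ]
  funext κ u
  have hL : (Lc : ℝ) ^ (2 * (d + 1)) ≠ 0 := pow_ne_zero _ (Nat.cast_ne_zero.2 (NeZero.ne Lc))
  have e : lamCoeffK (KStepUnit (d := d) Lc (j + 1)) ((smStep d Lc j) ^ 2 • E2 d Lc (j + 1)) Lc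
      = fun μ y κ' u' => (-(((Lc : ℝ) ^ (2 * (d + 1)))⁻¹)) *
          contourSumAdj Lc (fun κ'' y'' => ((Lc : ℝ) ^ (j + 1)) ^ (2 * (d + 1)) * wΦ (N := Lc ^ (j + 2)) (d := d) κ'' μ (y'' - y)) κ' u' := by
    funext μ y κ' u'
    rw [lamCoeffK_KStepUnit_eq_neg_tent, neg_mul]
  rw [e, SLam_const_mul, smul_smul]
  congr 1
  field_simp

end Tower

end Summit.QuantumFields.BalabanUV.Beta.GAN24.BornLambdaTent

end
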